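import Literature.NumberTheory.LFunctions.UniformClassGroupZeroSum
import Literature.NumberTheory.LFunctions.ClassGroupLogFreeTheorem14AllDegrees
import Literature.NumberTheory.LFunctions.DedekindZeta1LogFreeTheorem14AllDegrees
import Summits.QuantumAdvantage.QuantumAdvantage.Theorems.LinnikCubicClassGroupsDegreeOnePrimesEscapePerCharacterDeficitDensity
import HarnessLib

/-!
# The additive class prime number theorem, I: log-free zero density for the whole family
# `{ζ₁_K} ∪ {L₀(s,χ)}_{χ ≠ 1}` of a number field of ONE degree, in `Q`-form

Topic `Summits/QuantumAdvantage/QuantumAdvantage/Theorems`, cell B2b-1 (linnik-cubic), PART A, the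
`stub_classPNTAdditive` slice of the line `dedekind-s3-collision` for the crux `DegreeOnePrimesEscape`
(stmt-QuantumAdvantage-11543) of route `LinnikCubicClassGroups`, in DEGREE-LOCAL form.
HONEST FRAMING: the value of this file is a THEOREM (kernel-checked lemma) — not summit progress.

The tree's `fam_density` (`Literature/…/UniformClassGroupZeroSum.lean`) packages the log-free
zero-density estimates of the family `F_ψ` (`F_0 = ζ₁_K`, `F_ψ = L₀(·, χ_ψ)`) for IMAGINARY QUADRATIC
fields.  Here is the same package for the number fields of an arbitrary fixed degree `n > 1`, fed by the
all-degree estimates `logFreeDensity_classGroup_all` (X1) and `logFreeDensity_dedekindZeta₁_all` (X2) of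
the cell, with the residue lower bound `κ_K ≥ Q^{−A}` (`Q = condQn K = |d_K| n^n`) kept as a hypothesis
and the size parameter `P = Q^a (T + 2)`, `a = max A 4` (`sizeParam_admissible`):

* `fam_density_local (n) (hn) (A)` — there are `b, D > 0` (depending on `n, A`) such that for every `K`
  of degree `n` with `κ_K ≥ Q^{−A}`, every `T ≥ 1`, `α ≤ 1` and all finite sets `u ψ` of zeros of `F_ψ`
  with `1/4 ≤ β < 1`, `|γ| ≤ T`:
  `Σ_ψ Σ_{ρ ∈ u ψ, α ≤ β} m_ψ(ρ) ≤ D · e^{b(a log Q + log(T + 4))(1 − α)}`.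

## References

* J. Thorner, A. Zaman, ANT 13 (2019), Theorem 3.2 (without the Deuring–Heilbronn factor). [ThornerZaman2019]
* A. Weiss, J. reine angew. Math. 338 (1983), Thm. 4.3. [Weiss1983]
-/

noncomputable section

open Complex Real MeasureTheory Set Filter Topology
open scoped NumberField nonZeroDivisors

namespace Summit.QuantumAdvantage.QuantumAdvantage.Theorems.DegreeOnePrimesEscape

open Literature.NumberTheory.LFunctions Literature.NumberTheory.LFunctions.NumberField
  Literature.NumberTheory.LFunctions.EntireEF Literature.NumberTheory.LFunctions.LogFreeDensity
  Literature.NumberTheory.LFunctions.LogFreeLocal Literature.NumberTheory.LFunctions.AbelianDensity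

/-- **Log-free zero density for the family of a number field of degree `n`, in `Q`-form** (the
degree-local twin of the tree's `fam_density`): there are `b, D > 0` such that for every number field
`K` of degree `n > 1` with `κ_K ≥ Q^{−A}`, every `T ≥ 1`, every `α ≤ 1` and all finite sets `u ψ` of
zeros of `F_ψ` with `1/4 ≤ β < 1`, `|γ| ≤ T`:
`Σ_ψ Σ_{ρ ∈ u ψ, α ≤ β} m_ψ(ρ) ≤ D · e^{b(a log Q + log(T + 4))(1 − α)}`, `a = max A 4`, `Q = condQn K`
(`logFreeDensity_classGroup_all` + `logFreeDensity_dedekindZeta₁_all` at `P = Q^a (T + 2)`). -/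
theorem fam_density_local (n : ℕ) (hn : 1 < n) (A : ℝ) : ∃ b D : ℝ, 0 < b ∧ 0 < D ∧
    ∀ (K : Type) [Field K] [NumberField K], Module.finrank ℚ K = n →
      ThornerZaman.condQn K ^ (-A) ≤ NumberField.dedekindZeta_residue K →
      ∀ (T : ℝ), 1 ≤ T → ∀ u : AddChar (Additive (ClassGroup (𝓞 K))) ℂ → Finset ℂ,
        (∀ ψ, ∀ ρ ∈ u ψ, famF K ψ ρ = 0 ∧ 1 / 4 ≤ ρ.re ∧ ρ.re < 1 ∧ |ρ.im| ≤ T) →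
        ∀ α : ℝ, α ≤ 1 →
          ∑ ψ, ∑ ρ ∈ u ψ with α ≤ ρ.re, (famMult K ψ ρ : ℝ) ≤
            D * Real.exp (b * (max A 4 * Real.log (ThornerZaman.condQn K) + Real.log (T + 4))) ^ (1 - α) := by
  classical
  obtain ⟨c₁, C₁, hc₁, hC₁, hCG⟩ := logFreeDensity_classGroup_all n
  obtain ⟨c₂, C₂, hc₂, hC₂, hZ1⟩ := logFreeDensity_dedekindZeta₁_all n
  refine ⟨max c₁ c₂, C₁ + C₂, by positivity, by positivity, fun K _ _ hKn hκ T hT u hu α hα1 ↦ ?_⟩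
  have hK : 1 < Module.finrank ℚ K := by rw [hKn]; exact hn
  set a : ℝ := max A 4 with ha
  set Q : ℝ := ThornerZaman.condQn K with hQ
  have hQ12 : (12 : ℝ) ≤ Q := ThornerZaman.twelve_le_condQn (K := K) hK
  have hQ1 : (1 : ℝ) ≤ Q := by linarith
  set P : ℝ := Q ^ a * (T + 2) with hP
  obtain ⟨hP2, hdP, hhP, hκP, hTP⟩ :=
    sizeParam_admissible K hK (le_max_left A 4) (le_max_right A 4) hT hκ
  -- clamp `α` at `0`
  set α' : ℝ := max α 0 with hα'
  have hα'0 : 0 ≤ α' := le_max_right _ _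
  have hα'1 : α' ≤ 1 := max_le hα1 zero_le_one
  have hfilter : ∀ ψ, (u ψ).filter (fun ρ ↦ α ≤ ρ.re) = (u ψ).filter (fun ρ ↦ α' ≤ ρ.re) := by
    intro ψ
    refine Finset.filter_congr fun ρ hρ ↦ ?_
    have := (hu ψ ρ hρ).2.1
    rw [hα', max_le_iff]
    exact ⟨fun h ↦ ⟨h, by linarith⟩, fun h ↦ h.1⟩
  simp_rw [hfilter]
  -- the `χ ≠ 1` part
  set Z : (ClassGroup (𝓞 K) →* ℂˣ) → Finset ℂ := fun χ ↦
    (Finset.univ.filter fun ψ : AddChar (Additive (ClassGroup (𝓞 K))) ℂ ↦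
      (toMulHom ψ).toHomUnits = χ).biUnion u with hZdef
  have hZψ : ∀ ψ, Z (toMulHom ψ).toHomUnits = u ψ := by
    intro ψ
    rw [hZdef]; dsimp only
    have : (Finset.univ.filter fun ψ' : AddChar (Additive (ClassGroup (𝓞 K))) ℂ ↦
        (toMulHom ψ').toHomUnits = (toMulHom ψ).toHomUnits) = {ψ} := by
      ext ψ'
      simp only [Finset.mem_filter, Finset.mem_univ, true_and, Finset.mem_singleton]
      exact ⟨fun h ↦ toHomUnits_toMulHom_injective h, fun h ↦ by rw [h]⟩
    rw [this, Finset.singleton_biUnion]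
  have hline : ∀ χ : ClassGroup (𝓞 K) →* ℂˣ, χ ≠ 1 → ∀ ρ : ℂ,
      classGroupLFunction₀ K χ ρ = 0 → ρ.re < 1 := by
    intro χ hχ ρ h0
    by_contra h1; rw [not_lt] at h1
    exact classGroupLFunction₀_ne_zero_of_one_le_re hχ h1 h0
  have hZ : ∀ χ : ClassGroup (𝓞 K) →* ℂˣ, χ ≠ 1 → ∀ ρ ∈ Z χ,
      classGroupLFunction₀ K χ ρ = 0 ∧ 1 / 4 ≤ ρ.re ∧ ρ.re < 1 ∧ |ρ.im| ≤ P := by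
    intro χ hχ ρ hρ
    rw [hZdef] at hρ; dsimp only at hρ
    rw [Finset.mem_biUnion] at hρ
    obtain ⟨ψ, hψ, hρu⟩ := hρ
    rw [Finset.mem_filter] at hψ
    have hψ0 : ψ ≠ 0 := by
      rintro rfl; rw [toHomUnits_toMulHom_zero] at hψ; exact hχ hψ.2.symm
    obtain ⟨h0, h14, h1, hT'⟩ := hu ψ ρ hρu
    rw [famF_of_ne hψ0, hψ.2] at h0
    exact ⟨h0, h14, h1, hT'.trans hTP⟩
  have hA := hCG K hKn hline P hP2 hdP hhP hκP Z hZ α' hα'0 hα'1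
  -- the `ζ_K` part
  have hZ0 : ∀ ρ ∈ u 0, dedekindZeta₁ K ρ = 0 ∧ 1 / 4 ≤ ρ.re ∧ ρ.re < 1 ∧ |ρ.im| ≤ P := by
    intro ρ hρ
    obtain ⟨h0, h14, h1, hT'⟩ := hu 0 ρ hρ
    rw [famF_zero] at h0
    exact ⟨h0, h14, h1, hT'.trans hTP⟩
  have hB := hZ1 K hKn P hP2 hdP hhP hκP (u 0) hZ0 α' hα'0 hα'1
  -- assemble: split `Σ_ψ` into `ψ = 0` and `ψ ≠ 0`
  rw [← Finset.sum_filter_add_sum_filter_not Finset.univ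
    (fun ψ ↦ ψ = (0 : AddChar (Additive (ClassGroup (𝓞 K))) ℂ))]
  rw [Finset.filter_eq' Finset.univ (0 : AddChar (Additive (ClassGroup (𝓞 K))) ℂ),
    if_pos (Finset.mem_univ _), Finset.sum_singleton]
  have hA' : ∑ ψ ∈ Finset.univ.filter (fun ψ ↦ ¬ ψ = (0 : AddChar (Additive (ClassGroup (𝓞 K))) ℂ)),
      ∑ ρ ∈ (u ψ).filter (fun ρ ↦ α' ≤ ρ.re), (famMult K ψ ρ : ℝ) ≤ C₁ * P ^ (c₁ * (1 - α')) := by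
    refine le_of_eq_of_le ?_ hA
    refine Finset.sum_congr rfl fun ψ hψ ↦ ?_
    rw [Finset.mem_filter] at hψ
    rw [hZψ]
    refine Finset.sum_congr rfl fun ρ _ ↦ ?_
    rw [famMult, famF_of_ne hψ.2]; rfl
  have hB' : ∑ ρ ∈ (u 0).filter (fun ρ ↦ α' ≤ ρ.re), (famMult K 0 ρ : ℝ) ≤ C₂ * P ^ (c₂ * (1 - α')) := by
    refine le_of_eq_of_le (Finset.sum_congr rfl fun ρ _ ↦ ?_) hB
    rw [famMult, famF_zero]; rfl
  -- `P^{c(1-α')} ≤ exp(b(a log Q + log(T+4)))^{1-α}`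
  set B : ℝ := Real.exp (max c₁ c₂ * (a * Real.log Q + Real.log (T + 4))) with hBdef
  have hP1 : (1 : ℝ) ≤ P := by linarith
  have ha0 : 0 ≤ a := le_trans (by norm_num) (le_max_right A 4)
  have hQa0 : 0 < Q ^ a := Real.rpow_pos_of_pos (by linarith) _
  have hPexp : P ≤ Real.exp (a * Real.log Q + Real.log (T + 4)) := by
    rw [Real.exp_add, Real.exp_log (by linarith), show a * Real.log Q = Real.log (Q ^ a) by
      rw [Real.log_rpow (by linarith)], Real.exp_log hQa0, hP]
    nlinarith
  have hpow : ∀ {c : ℝ}, 0 < c → c ≤ max c₁ c₂ → P ^ (c * (1 - α')) ≤ B ^ (1 - α) := by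
    intro c hc hcm
    have h1α : 0 ≤ 1 - α' := by linarith
    have hαα : 1 - α' ≤ 1 - α := by rw [hα']; exact sub_le_sub_left (le_max_left _ _) _
    have hB1 : 1 ≤ B := Real.one_le_exp (by
      have : 0 ≤ Real.log Q := Real.log_nonneg hQ1
      have : 0 ≤ Real.log (T + 4) := Real.log_nonneg (by linarith)
      positivity)
    calc P ^ (c * (1 - α')) = (P ^ c) ^ (1 - α') := by rw [Real.rpow_mul (by linarith)]
      _ ≤ (Real.exp (a * Real.log Q + Real.log (T + 4)) ^ (max c₁ c₂)) ^ (1 - α') := by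
          refine Real.rpow_le_rpow (by positivity) ?_ h1α
          have hE1 : 1 ≤ Real.exp (a * Real.log Q + Real.log (T + 4)) := by linarith
          exact (Real.rpow_le_rpow (by linarith) hPexp hc.le).trans
            (Real.rpow_le_rpow_of_exponent_le hE1 hcm)
      _ = B ^ (1 - α') := by
          rw [hBdef, ← Real.exp_mul]; ring_nf
      _ ≤ B ^ (1 - α) := Real.rpow_le_rpow_of_exponent_le hB1 hαα
  have h1 := hpow hc₁ (le_max_left _ _)
  have h2' := hpow hc₂ (le_max_right _ _)
  have hBpos : 0 ≤ B ^ (1 - α) := Real.rpow_nonneg (Real.exp_pos _).le _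
  calc ∑ ρ ∈ (u 0).filter (fun ρ ↦ α' ≤ ρ.re), (famMult K 0 ρ : ℝ) +
        ∑ ψ ∈ Finset.univ.filter (fun ψ ↦ ¬ ψ = (0 : AddChar (Additive (ClassGroup (𝓞 K))) ℂ)),
          ∑ ρ ∈ (u ψ).filter (fun ρ ↦ α' ≤ ρ.re), (famMult K ψ ρ : ℝ)
      ≤ C₂ * P ^ (c₂ * (1 - α')) + C₁ * P ^ (c₁ * (1 - α')) := add_le_add hB' hA'
    _ ≤ C₂ * B ^ (1 - α) + C₁ * B ^ (1 - α) :=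
        add_le_add (mul_le_mul_of_nonneg_left h2' hC₂.le) (mul_le_mul_of_nonneg_left h1 hC₁.le)
    _ = (C₁ + C₂) * B ^ (1 - α) := by ring

end Summit.QuantumAdvantage.QuantumAdvantage.Theorems.DegreeOnePrimesEscape

end
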